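import Summits.ResolutionOfSingularities.ResolutionOfSingularities.Theorems.FrobeniusLadderFInjectiveMacaulayficationSigma5P2d4CNewtonKCoverRecords
import Summits.ResolutionOfSingularities.ResolutionOfSingularities.Theorems.FrobeniusLadderFInjectiveMacaulayficationSigma5P2d4CNewtonKFanChecks
import Summits.ResolutionOfSingularities.ResolutionOfSingularities.Theorems.FrobeniusLadderFInjectiveMacaulayficationFanCheckChunks
import Mathlib.Tactic.IntervalCases
import HarnessLib

/-!
# KERNEL CHECKS (cover records) of the class-route cover data for f′ = σ₅(f_P2d4C): the sparse multi-vertex cover records, ONE `decide +kernel` per block `j` of the product table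
# (crux `FInjectiveMacaulayfication` stmt-ResolutionOfSingularities-15315, chain w45a; (W-WND) class-route retro-fit PILOT, res-L1-w45a-plan-1 R22.4 (3); seat res-L1-w45a-stub-2 g11)

Support file for crux stmt-ResolutionOfSingularities-15315 (`FrobeniusLadder.FInjectiveMacaulayfication`), chain w45a.
[OURS · L1 W4.5a] — NOT a statement of any manuscript; AI-written, weaker than expert review.

`FanCheckChunks.checkHcovMultiL 5 (blockGens KL2 j) MV2 50 55 (RLMB j)` for `j = 0,…,4` (block `j` = the 157 generators `b + e_j`, records `RLM2_j` of `Sigma5P2d4CNewtonKCoverRecords`,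
certificate `sig5_cover.json` 86a530aef7d8e6b6; `Σ cnt ≤ 9660`), and the `∀ j < 5` form consumed by `FanCheckChunks.hcov_of_blocks`; `tlen` from `Sigma5P2d4CNewtonKFanChecks`. No definitions, no named facts. [folklore]
-/

-- single-problem summit: the doubled namespace component is forced
set_option linter.dupNamespace false

namespace Summit.ResolutionOfSingularities.ResolutionOfSingularities.Theorems.FInjectiveMacaulayfication.Sigma5P2d4CNewtonKFan

open Summit.ResolutionOfSingularities.ResolutionOfSingularities.Theorems.FInjectiveMacaulayfication
open FanCheckKit FanCheckSound FanCheckChunks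

/-- Cover records, block 0 (`b + e_0`), with the specimen-distinct conjunct `CL.length = 55`. -/
theorem check_hcov_0 : checkHcovMultiL 5 (blockGens KL2 0) MV2 50 55 (RLMB 0) = true ∧ CL.length = 55 := ⟨by decide +kernel, tlen⟩

/-- Cover records, block 1 (`b + e_1`), with the specimen-distinct conjunct `CL.length = 55`. -/
theorem check_hcov_1 : checkHcovMultiL 5 (blockGens KL2 1) MV2 50 55 (RLMB 1) = true ∧ CL.length = 55 := ⟨by decide +kernel, tlen⟩

/-- Cover records, block 2 (`b + e_2`), with the specimen-distinct conjunct `CL.length = 55`. -/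
theorem check_hcov_2 : checkHcovMultiL 5 (blockGens KL2 2) MV2 50 55 (RLMB 2) = true ∧ CL.length = 55 := ⟨by decide +kernel, tlen⟩

/-- Cover records, block 3 (`b + e_3`), with the specimen-distinct conjunct `CL.length = 55`. -/
theorem check_hcov_3 : checkHcovMultiL 5 (blockGens KL2 3) MV2 50 55 (RLMB 3) = true ∧ CL.length = 55 := ⟨by decide +kernel, tlen⟩

/-- Cover records, block 4 (`b + e_4`), with the specimen-distinct conjunct `CL.length = 55`. -/
theorem check_hcov_4 : checkHcovMultiL 5 (blockGens KL2 4) MV2 50 55 (RLMB 4) = true ∧ CL.length = 55 := ⟨by decide +kernel, tlen⟩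

/-- ★ All five block checks, in the `∀ j < 5` shape of `FanCheckChunks.hcov_of_blocks` (with the specimen-distinct conjunct). -/
theorem check_hcov : (∀ j < 5, checkHcovMultiL 5 (blockGens KL2 j) MV2 50 55 (RLMB j) = true) ∧ CL.length = 55 := by
  refine ⟨fun j hj => ?_, tlen⟩
  interval_cases j
  · exact check_hcov_0.1
  · exact check_hcov_1.1
  · exact check_hcov_2.1
  · exact check_hcov_3.1
  · exact check_hcov_4.1

end Summit.ResolutionOfSingularities.ResolutionOfSingularities.Theorems.FInjectiveMacaulayfication.Sigma5P2d4CNewtonKFan
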